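import Summits.Ventures.PercRepro.ProfileTwoTop
import Summits.Ventures.PercRepro.NullityHall

/-!
# PercRepro — THE NULLITY-2 BASE OF THE HALL ROW IS A STATEMENT ABOUT RANK-2 MATROIDS OF COGIRTH ≥ 3
(p10, gen 4; `proofs/P10-HALLROW.md` §5, nullity 2)

On `u + 2` elements a simple matroid `M` of rank `u` has a dual `M✶` of rank `2` and cogirth `≥ 3`
(`cogirthGe'_dual_three`), and the co-independent pairs of `M` are exactly the independent pairs of `M✶`
(`indepSets_dual_two`).  So the last hypothesis of the Hall row, Hall's condition for disjointness on
`coIndepPairs N` for the simple `N` of nullity `2`, is Hall's condition for disjointness on the independent pairs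
of a rank-`2` matroid of cogirth `≥ 3` on `≥ 7` elements — `RankTwoHall`:

* `coIndepPairs_eq_indepSets_dual` — `coIndepPairs M = indepSets M✶ 2` when `|E| = ρ(E) + 2`;
* `RankTwoHall` — the statement about rank-2 matroids;
* **`hallIneq_two_all_of_rankTwoHall`** — the Hall row for every finite matroid and every `u ≥ 5`, modulo `RankTwoHall`.

`RankTwoHall` is TRUE (paper: the parallel classes `P₁ … P_k` of the rank-2 matroid have `n′ − a_i ≥ 3`; the independent
pairs are the cross pairs; (G1)–(G3) of `hall_disjoint_pairs` hold outside the six configurations `(1,1,1,1)`,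
`(1,1,1,1,1)`, `(1,2,2)`, `(1,1,1,2)`, `(1,2,3)`, `(1,1,1,3)`, each of which has an explicit disjoint perfect matching)
but NOT proved here.
-/

open scoped Matroid

namespace PercRepro.Cogirth

open Finset ThmH Skew Shadow Profile HallDisjoint

variable {α : Type} [DecidableEq α] {M : Matroid α} [M.Finite]

/-- When `|E| = ρ(E) + 2` the co-independent pairs of a simple matroid are the independent pairs of its dual. -/
theorem coIndepPairs_eq_indepSets_dual (hs : Simple' M) (hnul : (gr M).card = rk M (gr M) + 2) :
    coIndepPairs M = indepSets (M✶) 2 := by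
  rw [indepSets_dual_two hs]
  ext C
  rw [mem_coIndepPairs, mem_filter]
  constructor
  · rintro ⟨hC, hI⟩
    refine ⟨hC, ?_⟩
    have h1 := rk_eq_card_of_indep hI
    rw [card_sdiff_of_subset (mem_indepSets.1 hC).1, (mem_indepSets.1 hC).2.1] at h1
    omega
  · rintro ⟨hC, hr⟩
    refine ⟨hC, ?_⟩
    apply indep_of_rk_eq_card
    rw [hr, card_sdiff_of_subset (mem_indepSets.1 hC).1, (mem_indepSets.1 hC).2.1]
    omega

/-- **Hall's condition for disjointness on the independent pairs of a rank-2 matroid of cogirth `≥ 3`** on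
`≥ 7` elements (the base of the Hall row in the dual; TRUE on paper, not typed). -/
def RankTwoHall (α : Type) [DecidableEq α] : Prop :=
  ∀ (N : Matroid α) [N.Finite], rk N (gr N) = 2 → CogirthGe' N 3 → 7 ≤ (gr N).card →
    ∀ 𝒜 ⊆ indepSets N 2, 𝒜.card ≤ (nbr (indepSets N 2) 𝒜).card

/-- **The Hall row `(H⁺_{2,u})` for every finite matroid and every `u ≥ 5`, modulo `RankTwoHall`.** -/
theorem hallIneq_two_all_of_rankTwoHall (hR : RankTwoHall α) {u : ℕ} (hu : 5 ≤ u) (M : Matroid α) [M.Finite] :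
    HallIneq M 2 u := by
  apply hallIneq_two_all_of_nullity_two_hall hu
  intro N _ hs hn hrk 𝒜 h𝒜
  have hnul : (gr N).card = rk N (gr N) + 2 := by omega
  rw [coIndepPairs_eq_indepSets_dual hs hnul] at h𝒜 ⊢
  have hrk2 : rk (N✶) (gr (N✶)) = 2 := by
    rw [gr_dual]
    have := rk_dual_add_rk (M := N)
    omega
  have h7 : 7 ≤ (gr (N✶)).card := by
    rw [gr_dual]
    omega
  exact hR (N✶) hrk2 (cogirthGe'_dual_three hs) h7 𝒜 h𝒜

end PercRepro.Cogirth
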